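import Summits.QuantumFields.BalabanUV.Beta.SymSliceProjectorRules
import Summits.QuantumFields.BalabanUV.Beta.AxialCoordinateProjectorCoarse

/-!
# `BalabanUV.Beta.SymRootedDressingKernel` — binder row D1, RULING R-D1-g35-1 (chart (III′)), brick B2 part 1: THE ROOTED SYMMETRISED PROJECTOR
# `Π^{sym}_ρ = 1 − grad ∘ symGaugeAt ρ` AS A MATRIX `pmSym` AND AS A KERNEL `piKSym` — formula, window, bound, decay, spread
# (port of `SymmetrisedDressingMatrix` §2 + `SymmetrisedDressingKernel` §1 with the `blockMeanAt` terms DELETED; an3 g78 W-an3-g78-1 (V3))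

HONEST FRAMING (cell contract, verbatim): «discharging `BetaPertH` makes Bałaban's UV stability UNCONDITIONAL — a real constructive-QFT
result; it is NOT the continuum limit and NOT the Clay problem.»  HONEST DEPENDENCY: continuum YM on T⁴ ⇐ BetaPertH ∧ nine spine estimates (0/9 proved);
BetaPertH ⇐ (D1) ∧ (D4) ∧ CAP+tail; G-an2-4 gates asym, D1 and NE2/3/4.
DERIVED cell leaf (β sub-cell, BINDER-OWNERS row D1 OWNER `b2b-balaban-beta-an2` gen 35; brick B2 of RULING R-D1-g35-1, memo
`HOME/b2b-balaban-beta-an2/gen35/R-D1-g35-1-CHART-IIIprime.v1.md`; located by an3 g78, memo `QAN2G351-AN3.v1.md` §3 (V1)–(V3)).  WHY.  The P2 transport lemma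
`RelInvBlindTransport.relInv_transport_of_blind` needs an auxiliary dressing `S` with range in the sym slice (`E_s∘S = S`) whose kernel is the CENTRE-TRIVIAL gauges
(so that the legged spread is blind to it and the rooted comb dressing absorbs it: `P∘S = P`).  The block-mean projector `piKSymBm` of chart (II) has the wrong
kernel class (`SymmetrisedAxialGaugeBlockMean.symLinAvgAt_symAxProjBmAt`: the legs see it); the ROOTED symmetrised projector `SymmetrisedAxialGauge.symAxProjAt ρ`
(`= A − grad (symGaugeAt ρ A N)`, gauge parameter `0` at every block root) has the right one (`symLinAvgAt_symAxProjAt`, an3's scratch `axProjAt_symAxProjAt`).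
THIS FILE types its matrix and kernel: §1 `pmSym ρ N β p α q := (Π^{sym}_ρ δ_{(α,q)})_β(p)` with formula, window `p − q ∈ cube`, bound `1 + 2·n·N`; §2 the kernel
`piKSym` (field block windowed `pmSym`, multiplier block the identity — same convention as `piK` ∕ `piKBm` ∕ `piKSymBm`), entries, unwindowing, decay at every rate
(constant `cPb`), spread of it and of its transpose; §3 the coarse-restricted twin `piKSymC`, substitution lemmas, and **K3** `symEc ∘ trK piKSym = trK piKSymC` (port of
`SymSliceProjectorRules.comp_symEc_trK_piKSymBm` over `symAxialGaugeAt_symAxProjAt`) with its weak shape `symEc ∘ (trK piKSym ∘ axEc) = trK piKSym ∘ axEc`.  NOT HERE (B2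
parts 2–3, OFFERED): K2 (the legged spread is blind to `trK piKSym`), K4 (`trK piK ∘ trK piKSym = trK piK`).  No statement of Bałaban's papers, no `[cite:]`, no `Prop` fact; THREE bookkeeping data defs `pmSym`, `piKSym`, `piKSymC` ([our objects —
a matrix and two kernels, asserting nothing]).  Discharges NO binder; RECORD = ROOT M′ unchanged; NOT D1, NOT `BetaPertH`, NOT continuum, NOT Clay.
Provenance: β sub-cell, unit beta-an2 gen 35, 2026-08-21 (v1); decl-by-decl port of `SymmetrisedDressingMatrix` §2 ∕ `SymmetrisedDressingKernel` §1 (an2 gen 24) BY NAME;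
no existing file touched.
-/

noncomputable section

open Finset
open scoped BigOperators Nat
open Literature.MathematicalPhysics.QuantumFieldTheory
open Literature.MathematicalPhysics.QuantumFieldTheory.Balaban1983to89
open Literature.MathematicalPhysics.QuantumFieldTheory.Balaban1983to89.Beta
open B12Sec2to5 (l1 l1_nonneg)
open ExpKernelCalculus (MKer Decays comp tr shiftK l1_sub_symm)
open AffineAveraging (Form0 Form1 Site box toSite unitVec unitVec_apply blockSum)
open AveragingContours (blk grad shift)
open AveragingContoursRooted (ctr ctrOff ctrOff_mem_box)
open Literature.Probability.LatticeModels (Torus.proj)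
open OneStepResolventKernel (Fib)
open Summit.QuantumFields.BalabanUV.Beta.TameKernelCalculus
open Summit.QuantumFields.BalabanUV.Beta.AxialDressingRooted
open Summit.QuantumFields.BalabanUV.Beta.SymmetrisedAxialGauge
open Summit.QuantumFields.BalabanUV.Beta.SymmetrisedAxialGaugeBlockMean (symGaugeAt symAxProjAt_eq_sub)
open Summit.QuantumFields.BalabanUV.Beta.SymmetrisedDressingMatrix (bondIndR bondIndR_apply symGaugeAt_bondIndR_ne_zero_blk sub_mem_cube_of_blk_eq
  sub_mem_cube_of_blk_eq_succ abs_symGaugeAt_bondIndR_le)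
open Summit.QuantumFields.BalabanUV.Beta.SymSliceBlockMatrix (BIdx)
open Summit.QuantumFields.BalabanUV.Beta.SymSliceProjectorKernel (symEc IsIntBond)
open Summit.QuantumFields.BalabanUV.Beta.SymSliceProjectorRules (comp_symEc_apply_inr comp_symEc_apply_inl_of_not_int comp_symEc_apply_inl_of_int
  sum_Pmat_mul_apply_of_symAxialGaugeAt)

namespace Summit.QuantumFields.BalabanUV.Beta.SymRootedDressingKernel

/-! ## §1 The matrix `pmSym` of the ROOTED symmetrised projector: formula, window, bound -/

section Matrix

variable {n : ℕ}

/-- [our object — a matrix, asserting nothing] **THE MATRIX OF THE ROOTED SYMMETRISED PROJECTOR**: `pmSym ρ N β p α q := (Π^{sym}_ρ δ_{(α,q)})_β(p)`,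
`Π^{sym}_ρ = SymmetrisedAxialGauge.symAxProjAt ρ N` (cf. `SymmetrisedDressingMatrix.pmSymBm`, the block-mean variant). -/
def pmSym (ρ : Fin n → ℤ) (N : ℕ) (β : Fin n) (p : Fin n → ℤ) (α : Fin n) (q : Fin n → ℤ) : ℝ :=
  symAxProjAt ρ N (bondIndR α q) β p

/-- [folklore] THE FORMULA: `pmSym = δ − (g(p + e_β) − g(p))`, `g = (n!)⁻¹·symTreeGaugeAt ρ δ_{(α,q)} = symGaugeAt ρ δ_{(α,q)}`. -/
theorem pmSym_eq (ρ : Fin n → ℤ) (N : ℕ) (β : Fin n) (p : Fin n → ℤ) (α : Fin n) (q : Fin n → ℤ) :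
    pmSym ρ N β p α q = bondIndR α q β p - (symGaugeAt ρ (bondIndR α q) N (p + unitVec β) - symGaugeAt ρ (bondIndR α q) N p) := by
  rw [pmSym, symAxProjAt_eq_sub]
  rfl

/-- [folklore] **THE WINDOW**: `pmSym (toSite r) N β p α q ≠ 0 → p − q ∈ cube n N` (in-block root, `N ≥ 1`). -/
theorem window_of_pmSym_ne_zero {N : ℕ} (hN : 1 ≤ N) {r : Fin n → ℕ} (hr : r ∈ box n N) {β : Fin n} {p : Fin n → ℤ} {α : Fin n}
    {q : Fin n → ℤ} (h : pmSym (toSite r) N β p α q ≠ 0) : p - q ∈ cube n N := by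
  rw [pmSym_eq] at h
  by_contra hw
  apply h
  have h0 : bondIndR α q β p = 0 := by
    rw [bondIndR_apply, if_neg]
    rintro ⟨-, rfl⟩
    exact hw (by rw [sub_self]; exact AxialDressingRooted.zero_mem_cube N)
  have g1 : symGaugeAt (toSite r) (bondIndR α q) N (p + unitVec β) = 0 := by
    by_contra h1; exact hw (sub_mem_cube_of_blk_eq_succ hN (symGaugeAt_bondIndR_ne_zero_blk hN hr h1).1)
  have g2 : symGaugeAt (toSite r) (bondIndR α q) N p = 0 := by
    by_contra h1; exact hw (sub_mem_cube_of_blk_eq hN (symGaugeAt_bondIndR_ne_zero_blk hN hr h1).1)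
  rw [h0, g1, g2]; ring

/-- [folklore] **THE BOUND**: `|pmSym (toSite r) N β p α q| ≤ 1 + 4·n·N` (in-block root; the block-mean variant's constant, kept so that the kernel below decays with
the SAME constant `cPb` as `piKBm` ∕ `piKSymBm`). -/
theorem abs_pmSym_le {N : ℕ} (hN : 1 ≤ N) {r : Fin n → ℕ} (hr : r ∈ box n N) (β : Fin n) (p : Fin n → ℤ) (α : Fin n)
    (q : Fin n → ℤ) : |pmSym (toSite r) N β p α q| ≤ 1 + 4 * ((n : ℝ) * N) := by
  rw [pmSym_eq]
  have h0 : |bondIndR α q β p| ≤ 1 := by rw [bondIndR_apply]; split <;> simp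
  have h1 := abs_symGaugeAt_bondIndR_le hN hr α q (p + unitVec β)
  have h2 := abs_symGaugeAt_bondIndR_le hN hr α q p
  have hnn : (0 : ℝ) ≤ (n : ℝ) * N := by positivity
  calc |bondIndR α q β p - (symGaugeAt (toSite r) (bondIndR α q) N (p + unitVec β) - symGaugeAt (toSite r) (bondIndR α q) N p)|
      ≤ |bondIndR α q β p| + (|symGaugeAt (toSite r) (bondIndR α q) N (p + unitVec β)| + |symGaugeAt (toSite r) (bondIndR α q) N p|) :=
        (abs_sub _ _).trans (add_le_add le_rfl (abs_sub _ _))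
    _ ≤ 1 + (((n : ℝ) * N) + ((n : ℝ) * N)) := add_le_add h0 (add_le_add h1 h2)
    _ ≤ 1 + 4 * ((n : ℝ) * N) := by linarith

end Matrix

/-! ## §2 The kernel `piKSym` of the ROOTED symmetrised projector -/

section Kernel

variable {d : ℕ}

/-- [our object — a kernel, asserting nothing] **THE ROOTED SYMMETRISED PROJECTOR KERNEL** `piKSym ρ N`: field block `[x′ − x ∈ cube]·pmSym ρ N β x′ α x`,
multiplier block the identity (cf. `piKSymBm`; `piKSym` represents `Π̂ᵀ` and `trK piKSym` represents `Π̂` in the cell's operator convention). -/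
def piKSym (ρ : Fin (d + 1) → ℤ) (N : ℕ) : MKer (d + 1) (Fib d) :=
  fun x x' a b =>
    match a, b with
    | Sum.inl α, Sum.inl β => if x' - x ∈ cube (d + 1) N then pmSym ρ N β x' α x else 0
    | Sum.inl _, Sum.inr _ => 0
    | Sum.inr _, Sum.inl _ => 0
    | Sum.inr m, Sum.inr m' => if x = x' ∧ m = m' then 1 else 0

variable (ρ : Fin (d + 1) → ℤ) (N : ℕ)

/-- [folklore] Field–field entry. -/
theorem piKSym_inl_inl (x x' : Fin (d + 1) → ℤ) (α β : Fin (d + 1)) :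
    piKSym ρ N x x' (Sum.inl α) (Sum.inl β) = if x' - x ∈ cube (d + 1) N then pmSym ρ N β x' α x else 0 := rfl

/-- [folklore] Field–multiplier entry vanishes. -/
theorem piKSym_inl_inr (x x' : Fin (d + 1) → ℤ) (α m : Fin (d + 1)) : piKSym ρ N x x' (Sum.inl α) (Sum.inr m) = 0 := rfl

/-- [folklore] Multiplier–field entry vanishes. -/
theorem piKSym_inr_inl (x x' : Fin (d + 1) → ℤ) (m α : Fin (d + 1)) : piKSym ρ N x x' (Sum.inr m) (Sum.inl α) = 0 := rfl

/-- [folklore] Multiplier–multiplier entry is the identity. -/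
theorem piKSym_inr_inr (x x' : Fin (d + 1) → ℤ) (m m' : Fin (d + 1)) :
    piKSym ρ N x x' (Sum.inr m) (Sum.inr m') = if x = x' ∧ m = m' then 1 else 0 := rfl

/-- [folklore] WITHOUT the window (in-block root): the window is automatic by §1's support lemma. -/
theorem piKSym_inl_inl_eq {N : ℕ} (hN : 1 ≤ N) {r : Fin (d + 1) → ℕ} (hr : r ∈ box (d + 1) N) (x x' : Fin (d + 1) → ℤ) (α β : Fin (d + 1)) :
    piKSym (toSite r) N x x' (Sum.inl α) (Sum.inl β) = pmSym (toSite r) N β x' α x := by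
  rw [piKSym_inl_inl]
  split_ifs with h
  · rfl
  · by_contra h0
    exact h (window_of_pmSym_ne_zero hN hr (Ne.symm h0))

/-- [folklore] … i.e. the field–field entry IS the rooted symmetrised projector of the bond indicator: `(Π^{sym}_ρ δ_{(α,x)})_β(x′)`. -/
theorem piKSym_inl_inl_eq_symAxProjAt {N : ℕ} (hN : 1 ≤ N) {r : Fin (d + 1) → ℕ} (hr : r ∈ box (d + 1) N) (x x' : Fin (d + 1) → ℤ)
    (α β : Fin (d + 1)) : piKSym (toSite r) N x x' (Sum.inl α) (Sum.inl β) = symAxProjAt (toSite r) N (bondIndR α x) β x' := by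
  rw [piKSym_inl_inl_eq hN hr]; rfl

/-- [folklore] Column contraction, field column: a windowed `pmSym`-sum. -/
theorem sum_piKSym_col_inl (u u' : Fin (d + 1) → ℤ) (κ' : Fin (d + 1)) (g : Fib d → ℝ) :
    ∑ f : Fib d, piKSym ρ N u u' f (Sum.inl κ') * g f =
      if u' - u ∈ cube (d + 1) N then ∑ κ : Fin (d + 1), pmSym ρ N κ' u' κ u * g (Sum.inl κ) else 0 := by
  rw [Fintype.sum_sum_type]
  simp only [piKSym_inl_inl, piKSym_inr_inl, zero_mul, Finset.sum_const_zero, add_zero]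
  split_ifs
  · rfl
  · simp

/-- [folklore] **`piKSym` DECAYS AT EVERY RATE** (in-block root; same constant `cPb` as `piKBm` ∕ `piKSymBm`). -/
theorem decays_piKSym {N : ℕ} (hN : 1 ≤ N) {r : Fin (d + 1) → ℕ} (hr : r ∈ box (d + 1) N) {δ : ℝ} (hδ : 0 ≤ δ) :
    Decays (piKSym (toSite r) N) (cPb d N δ) δ := by
  intro x x' a b
  have hpos : 0 ≤ cPb d N δ * Real.exp (-δ * l1 (x - x')) := mul_nonneg (cPb_nonneg d N δ) (Real.exp_pos _).le
  rcases a with α | m <;> rcases b with β | m'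
  · rw [piKSym_inl_inl]
    split_ifs with h
    · have hl : l1 (x - x') ≤ ((d : ℝ) + 1) * N := by
        rw [l1_sub_symm]
        have := l1_le_of_mem_cube h
        push_cast at this
        exact this
      have hpm := abs_pmSym_le hN hr β x' α x
      have hdn : ((d + 1 : ℕ) : ℝ) = (d : ℝ) + 1 := by push_cast; ring
      rw [hdn] at hpm
      have hA : (0 : ℝ) ≤ 1 + 4 * (((d : ℝ) + 1) * N) := by
        have : (0 : ℝ) ≤ ((d : ℝ) + 1) * N := by positivity
        linarith
      have he : (1 : ℝ) ≤ Real.exp (δ * (((d : ℝ) + 1) * N)) * Real.exp (-δ * l1 (x - x')) := by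
        rw [← Real.exp_add]
        exact Real.one_le_exp (by nlinarith)
      calc |pmSym (toSite r) N β x' α x| ≤ (1 + 4 * (((d : ℝ) + 1) * N)) * 1 := by rw [mul_one]; exact hpm
        _ ≤ (1 + 4 * (((d : ℝ) + 1) * N)) * (Real.exp (δ * (((d : ℝ) + 1) * N)) * Real.exp (-δ * l1 (x - x'))) :=
            mul_le_mul_of_nonneg_left he hA
        _ = cPb d N δ * Real.exp (-δ * l1 (x - x')) := by unfold cPb; ring
    · rw [abs_zero]; exact hpos
  · rw [piKSym_inl_inr, abs_zero]; exact hpos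
  · rw [piKSym_inr_inl, abs_zero]; exact hpos
  · rw [piKSym_inr_inr]
    split_ifs with h
    · rw [h.1, sub_self, abs_one]
      have h0 : l1 (0 : Fin (d + 1) → ℤ) = 0 := by simp [l1]
      rw [h0, mul_zero, Real.exp_zero, mul_one]
      exact one_le_cPb d N hδ
    · rw [abs_zero]; exact hpos

/-- [folklore] `piKSym` is spread (in-block root). -/
theorem spr_piKSym {N : ℕ} (hN : 1 ≤ N) {r : Fin (d + 1) → ℕ} (hr : r ∈ box (d + 1) N) : Spr (piKSym (toSite r) N) :=
  ⟨cPb d N 1, 1, one_pos, decays_piKSym hN hr zero_le_one⟩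

/-- [folklore] So is its transpose. -/
theorem spr_trK_piKSym {N : ℕ} (hN : 1 ≤ N) {r : Fin (d + 1) → ℕ} (hr : r ∈ box (d + 1) N) : Spr (trK (piKSym (toSite r) N)) :=
  (spr_piKSym hN hr).trK

/-- [folklore] The centred instances (`ctr = toSite ∘ ctrOff`, `ctrOff_mem_box`): `piKSym (ctr (d+1) Lc) Lc` and its transpose are spread. -/
theorem spr_piKSym_ctr (Lc : ℕ) [NeZero Lc] : Spr (piKSym (ctr (d + 1) Lc) Lc) ∧ Spr (trK (piKSym (ctr (d + 1) Lc) Lc)) :=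
  ⟨spr_piKSym (one_le_of_neZero Lc) (ctrOff_mem_box (one_le_of_neZero Lc)),
    spr_trK_piKSym (one_le_of_neZero Lc) (ctrOff_mem_box (one_le_of_neZero Lc))⟩

end Kernel

/-! ## §3 The coarse-restricted kernel `piKSymC` and K3: `symEc ∘ Π̂^{sym}_ρc = Π̂^{sym}_ρc,C` (the RANGE of the rooted symmetrised dressing lies in the sym slice) -/

section Slice

variable {d : ℕ}

/-- [our object — a kernel, asserting nothing] **`piKSym` WITH THE NON-COARSE MULTIPLIER ROWS KILLED** (cf. `piKSymBmC`, `piKBmC`, `piKC`). -/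
def piKSymC (ρ : Fin (d + 1) → ℤ) (N : ℕ) : MKer (d + 1) (Fib d) :=
  fun x x' a b =>
    match a, b with
    | Sum.inl α, Sum.inl β => piKSym ρ N x x' (Sum.inl α) (Sum.inl β)
    | Sum.inl _, Sum.inr _ => 0
    | Sum.inr _, Sum.inl _ => 0
    | Sum.inr m, Sum.inr m' => if x = x' ∧ m = m' ∧ Torus.proj N x = 0 then 1 else 0

/-- [folklore] Field block of `piKSymC` is that of `piKSym`. -/
theorem piKSymC_inl_inl (ρ : Fin (d + 1) → ℤ) (N : ℕ) (x x' : Fin (d + 1) → ℤ) (α β : Fin (d + 1)) :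
    piKSymC ρ N x x' (Sum.inl α) (Sum.inl β) = piKSym ρ N x x' (Sum.inl α) (Sum.inl β) := rfl

/-- [folklore] Field–multiplier entry vanishes. -/
theorem piKSymC_inl_inr (ρ : Fin (d + 1) → ℤ) (N : ℕ) (x x' : Fin (d + 1) → ℤ) (α m : Fin (d + 1)) :
    piKSymC ρ N x x' (Sum.inl α) (Sum.inr m) = 0 := rfl

/-- [folklore] Multiplier–field entry vanishes. -/
theorem piKSymC_inr_inl (ρ : Fin (d + 1) → ℤ) (N : ℕ) (x x' : Fin (d + 1) → ℤ) (m α : Fin (d + 1)) :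
    piKSymC ρ N x x' (Sum.inr m) (Sum.inl α) = 0 := rfl

/-- [folklore] Multiplier block: the coarse indicator. -/
theorem piKSymC_inr_inr (ρ : Fin (d + 1) → ℤ) (N : ℕ) (x x' : Fin (d + 1) → ℤ) (m m' : Fin (d + 1)) :
    piKSymC ρ N x x' (Sum.inr m) (Sum.inr m') = if x = x' ∧ m = m' ∧ Torus.proj N x = 0 then 1 else 0 := rfl

/-- [folklore] **K3 — RULE 1 AT PROJECTOR LEVEL FOR THE ROOTED SYMMETRISED DRESSING**: `symEc ∘ Π̂^{sym}_ρc = Π̂^{sym}_ρc,C` (centred root, `N ≥ 1`): on interior rows the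
block-orthogonal slice projector fixes the gauge-fixed columns `Π^{sym}_ρc δ` (`symAxialGaugeAt_symAxProjAt` — the ROOTED projector lands in the slice exactly as the
block-mean one does), on face-crossing rows `symEc` is the identity, on multiplier rows the coarse indicator (port of `SymSliceProjectorRules.comp_symEc_trK_piKSymBm`). -/
theorem comp_symEc_trK_piKSym {N : ℕ} (hN : 1 ≤ N) :
    comp (symEc N) (trK (piKSym (ctr (d + 1) N) N)) = trK (piKSymC (d := d) (ctr (d + 1) N) N) := by
  have hr : ctrOff (d + 1) N ∈ box (d + 1) N := ctrOff_mem_box hN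
  have hctr : ctr (d + 1) N = toSite (ctrOff (d + 1) N) := rfl
  funext x y a b
  rcases a with α | m
  · by_cases hα : IsIntBond N α x
    · rw [comp_symEc_apply_inl_of_int hN _ hα]
      rcases b with β | m
      · have hcol : ∀ j : BIdx (d + 1) N, trK (piKSym (ctr (d + 1) N) N) ((N : ℤ) • blk N x + toSite j.1.2) y (Sum.inl j.1.1) (Sum.inl β)
            = symAxProjAt (ctr (d + 1) N) N (bondIndR β y) j.1.1 ((N : ℤ) • blk N x + toSite j.1.2) := fun j => by
          show piKSym (ctr (d + 1) N) N y _ (Sum.inl β) (Sum.inl j.1.1) = _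
          rw [hctr, piKSym_inl_inl_eq hN hr]; rfl
        simp_rw [hcol]
        rw [sum_Pmat_mul_apply_of_symAxialGaugeAt hN (by rw [hctr]; exact symAxialGaugeAt_symAxProjAt hr _) hα]
        show _ = piKSym (ctr (d + 1) N) N y x (Sum.inl β) (Sum.inl α)
        rw [hctr, piKSym_inl_inl_eq hN hr]; rfl
      · show _ = piKSymC (ctr (d + 1) N) N y x (Sum.inr m) (Sum.inl α)
        rw [piKSymC_inr_inl]
        exact Finset.sum_eq_zero fun j _ => by
          rw [show trK (piKSym (ctr (d + 1) N) N) ((N : ℤ) • blk N x + toSite j.1.2) y (Sum.inl j.1.1) (Sum.inr m)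
            = piKSym (ctr (d + 1) N) N y _ (Sum.inr m) (Sum.inl j.1.1) from rfl, piKSym_inr_inl, mul_zero]
    · rw [comp_symEc_apply_inl_of_not_int _ hα]
      rcases b with β | m
      · rfl
      · rfl
  · rw [comp_symEc_apply_inr]
    rcases b with β | m'
    · show (if Torus.proj N x = 0 then piKSym (ctr (d + 1) N) N y x (Sum.inl β) (Sum.inr m) else 0)
          = piKSymC (ctr (d + 1) N) N y x (Sum.inl β) (Sum.inr m)
      rw [piKSym_inl_inr, piKSymC_inl_inr, ite_self]
    · show (if Torus.proj N x = 0 then piKSym (ctr (d + 1) N) N y x (Sum.inr m') (Sum.inr m) else 0)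
          = piKSymC (ctr (d + 1) N) N y x (Sum.inr m') (Sum.inr m)
      rw [piKSym_inr_inr, piKSymC_inr_inr]
      by_cases hyx : y = x ∧ m' = m
      · obtain ⟨rfl, rfl⟩ := hyx
        by_cases hc : Torus.proj N y = 0
        · rw [if_pos hc, if_pos ⟨rfl, rfl⟩, if_pos ⟨rfl, rfl, hc⟩]
        · rw [if_neg hc, if_neg (fun h => hc h.2.2)]
      · rw [if_neg hyx, ite_self, if_neg (fun h => hyx ⟨h.1, h.2.1⟩)]

/-- [folklore] `Π̂^{sym}_ρ,C K = Π̂^{sym}_ρ K` when the multiplier ROWS of `K` vanish off the coarse sites (the restriction is invisible; termwise). -/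
theorem comp_trK_piKSymC_eq (ρ : Fin (d + 1) → ℤ) {N : ℕ} {K : MKer (d + 1) (Fib d)}
    (hK : ∀ x, Torus.proj N x ≠ 0 → ∀ z m b, K x z (Sum.inr m) b = 0) :
    comp (trK (piKSymC ρ N)) K = comp (trK (piKSym ρ N)) K := by
  funext x z a b
  unfold ExpKernelCalculus.comp
  refine tsum_congr fun y => Finset.sum_congr rfl fun f _ => ?_
  show piKSymC ρ N y x f a * K y z f b = piKSym ρ N y x f a * K y z f b
  rcases f with γ | m' <;> rcases a with α | m
  · rfl
  · rw [piKSymC_inl_inr, piKSym_inl_inr]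
  · rw [piKSymC_inr_inl, piKSym_inr_inl]
  · rw [piKSymC_inr_inr, piKSym_inr_inr]
    by_cases hc : Torus.proj N y = 0
    · by_cases hyx : y = x ∧ m' = m
      · rw [if_pos ⟨hyx.1, hyx.2, hc⟩, if_pos hyx]
      · rw [if_neg (fun h => hyx ⟨h.1, h.2.1⟩), if_neg hyx]
    · rw [hK y hc z m' b, mul_zero, mul_zero]

/-- [folklore] `K Π̂ᵀ^{sym}_ρ,C = K Π̂ᵀ^{sym}_ρ` when the multiplier COLUMNS of `K` vanish off the coarse sites. -/
theorem comp_piKSymC_eq (ρ : Fin (d + 1) → ℤ) {N : ℕ} {A : MKer (d + 1) (Fib d)}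
    (hA : ∀ z, Torus.proj N z ≠ 0 → ∀ x a m, A x z a (Sum.inr m) = 0) :
    comp A (piKSymC ρ N) = comp A (piKSym ρ N) := by
  funext x z a b
  unfold ExpKernelCalculus.comp
  refine tsum_congr fun y => Finset.sum_congr rfl fun f _ => ?_
  rcases f with l | l <;> rcases b with β | m
  · rfl
  · rfl
  · rfl
  · rw [piKSymC_inr_inr, piKSym_inr_inr]
    by_cases h : y = z ∧ l = m
    · obtain ⟨rfl, rfl⟩ := h
      by_cases hc : Torus.proj N y = 0
      · simp [hc]
      · rw [hA y hc]; simp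
    · rw [if_neg h, if_neg (fun h' => h ⟨h'.1, h'.2.1⟩)]

/-- [folklore] **K3 IN THE WEAK (range) SHAPE the transport lemma consumes**: `symEc ∘ (Π̂^{sym}_ρc ∘ axEc ρc) = Π̂^{sym}_ρc ∘ axEc ρc` — after the coarse comb slice kills
the idle multiplier legs, the coarse restriction is invisible (`RelInvBlindTransport.relInv_transport_of_blind`'s `hEsS` at `S := trK piKSym`). -/
theorem comp_symEc_comp_trK_piKSym_axEc {N : ℕ} (hN : 1 ≤ N) :
    comp (symEc N) (comp (trK (piKSym (ctr (d + 1) N) N)) (axEc (ctr (d + 1) N) N)) =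
      comp (trK (piKSym (ctr (d + 1) N) N)) (axEc (d := d) (ctr (d + 1) N) N) := by
  have hr : ctrOff (d + 1) N ∈ box (d + 1) N := ctrOff_mem_box hN
  have sE : Spr (symEc (d := d) N) := SymSliceProjectorSpread.spr_symEc hN
  have sS : Spr (trK (piKSym (d := d) (ctr (d + 1) N) N)) := spr_trK_piKSym hN hr
  have sC : Spr (axEc (d := d) (ctr (d + 1) N) N) := spr_axEc _ _
  have hAx : ∀ x, Torus.proj N x ≠ 0 → ∀ z m b, axEc (d := d) (ctr (d + 1) N) N x z (Sum.inr m) b = 0 := by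
    intro x hx z m b
    rcases b with β | m'
    · rfl
    · rw [axEc_inr_inr, if_neg (fun h => hx h.2.2)]
  rw [comp_assoc_tame sE.tame sS.tame sC.tame, comp_symEc_trK_piKSym hN, comp_trK_piKSymC_eq _ hAx]

end Slice

end Summit.QuantumFields.BalabanUV.Beta.SymRootedDressingKernel

end
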